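import Summits.CriticalPhenomena.PercolationContinuityZ3.Theorems.Transplant.FKThreeApexT3EnvelopeReduction
import HarnessLib

/-!
# The three-apex monoid: the envelope statement (A) for `q ∈ [1/2, 1]` — an exact LP certificate — and type T3 on `[1/2, 1]`

Helper file (`--supports stmt-CriticalPhenomena-4575`), FK sub-lane `prim-bschramm-fk-3` (gen 16); builds on p205010 (kernel theorem, internal audit
signed; external expert review pending).  No sorries; standard axioms.  Memo `bschramm/prim-bschramm-fk-3/T3-ENVELOPE.md` §6.

The two-parameter frontier form `vForm q θ θ' Z` (file `…T3Envelope`) is, identically in `(q, θ, θ', Z)`, the sum `certHalf1 + … + certHalf4` of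
199 products `c · (2q−1)^k (2−2q)^{4−k} · θ^i θ'^j · G(Z)` with rational `c > 0` and `G` one of the valid forms on the monoid: the master forms
`N^{ab}, N^{ac}, N^{bc}` (Theorem M), the kap/S forms `ûv̂ − x̂ŷ, …` (`InK.s_nonneg`), `Λ` (`InK.lam_nonneg`), the masses `M_a, M_b, M_c`, products of
non-negative fibre masses, and the U-forms `Φ_a = uForm`, `Φ_b = phiB`, `Φ_c = phiC` at monomial weights (`InK.uCond`, `InK.phiB_nonneg`).  The
certificate was found by linear programming and solved exactly over `ℚ` (kit j158061/j158090; denominators ≤ 5184); the identity is checked by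
`ring` (`vForm_eq_certHalf`) and each term is non-negative for `q ∈ [1/2,1]`, `θ, θ' ≥ 0`, `Z ∈ InK q` (`envelopeA_of_half_le`).  With the reduction
`InK.t3Form_nonneg_of_envelopeA` this gives **`InK.t3Form_nonneg_of_half_le`: type T3 for every `q ∈ [1/2,1]`**, all leaf probabilities in
`[0,1]`, every rest in the monoid. [folklore]
-/

noncomputable section

namespace Summit.CriticalPhenomena.PercolationContinuityZ3.Theorems

namespace FK

namespace ThreeApex

/-! ### The certificate for `q ∈ [1/2, 1]` -/

/-- The apex-`c` upper-envelope form `Φ_c(w₁,w₂) = w₁²N^{ac} + w₂²N^{bc} + w₁w₂(N^{ac} + N^{bc} − M_c)`. [folklore] -/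
def phiC (q w₁ w₂ : ℝ) (Z : V5) : ℝ := w₁ ^ 2 * nAC q Z + w₂ ^ 2 * nBC q Z + w₁ * w₂ * (nAC q Z + nBC q Z - massC q Z)

/-- `Φ_c` is `Φ_a` of the `a ↔ c` relabelling (`= swapAB ∘ swapBC ∘ swapAB`). [folklore] -/
theorem phiC_eq_uForm (q w₁ w₂ : ℝ) (Z : V5) : phiC q w₁ w₂ Z = uForm q w₂ w₁ (swapAB (swapBC (swapAB Z))) := by
  simp only [phiC, uForm, nAC, nBC, massC, masterN, massA, swapAB, swapBC, hx, hy, hz, V5.total]; ring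

set_option maxHeartbeats 2000000 in
/-- Certificate block 1/4 for `(A)` on `q ∈ [1/2,1]`: non-negative rationals × Bernstein factors in `2q−1` × monomials in `θ, θ'` × valid forms
(found by linear programming, exact rational solve; kit j158090). [folklore] -/
def certHalf1 (q θ θ' : ℝ) (Z : V5) : ℝ :=
    ((3 : ℝ) / (2 : ℝ)) * (2 * q - 1) * (2 - 2 * q) ^ (3 : ℕ) * θ * θ' * nAB q Z
    + ((35 : ℝ) / (54 : ℝ)) * (2 * q - 1) ^ (2 : ℕ) * (2 - 2 * q) ^ (2 : ℕ) * θ * θ' * nAB q Z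
    + ((5 : ℝ) / (12 : ℝ)) * (2 - 2 * q) ^ (4 : ℕ) * θ * nAC q Z
    + ((25 : ℝ) / (18 : ℝ)) * (2 * q - 1) * (2 - 2 * q) ^ (3 : ℕ) * θ * nAC q Z
    + ((1 : ℝ) / (2 : ℝ)) * (2 - 2 * q) ^ (4 : ℕ) * θ ^ (2 : ℕ) * nAC q Z
    + ((131 : ℝ) / (54 : ℝ)) * (2 * q - 1) ^ (2 : ℕ) * (2 - 2 * q) ^ (2 : ℕ) * θ ^ (2 : ℕ) * nAC q Z
    + (1 : ℝ) * (2 - 2 * q) ^ (4 : ℕ) * θ ^ (2 : ℕ) * θ' * nAC q Z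
    + ((11 : ℝ) / (2 : ℝ)) * (2 * q - 1) * (2 - 2 * q) ^ (3 : ℕ) * θ ^ (2 : ℕ) * θ' * nAC q Z
    + ((185 : ℝ) / (27 : ℝ)) * (2 * q - 1) ^ (2 : ℕ) * (2 - 2 * q) ^ (2 : ℕ) * θ ^ (2 : ℕ) * θ' * nAC q Z
    + ((1199 : ℝ) / (324 : ℝ)) * (2 * q - 1) ^ (3 : ℕ) * (2 - 2 * q) * θ ^ (2 : ℕ) * θ' * nAC q Z
    + ((73 : ℝ) / (81 : ℝ)) * (2 * q - 1) ^ (4 : ℕ) * θ ^ (2 : ℕ) * θ' * nAC q Z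
    + ((1 : ℝ) / (2 : ℝ)) * (2 - 2 * q) ^ (4 : ℕ) * θ' * nBC q Z
    + (2 : ℝ) * (2 * q - 1) * (2 - 2 * q) ^ (3 : ℕ) * θ' * nBC q Z
    + ((1 : ℝ) / (2 : ℝ)) * (2 - 2 * q) ^ (4 : ℕ) * θ' ^ (2 : ℕ) * nBC q Z
    + ((85 : ℝ) / (54 : ℝ)) * (2 * q - 1) ^ (2 : ℕ) * (2 - 2 * q) ^ (2 : ℕ) * θ' ^ (2 : ℕ) * nBC q Z
    + ((11 : ℝ) / (12 : ℝ)) * (2 - 2 * q) ^ (4 : ℕ) * θ * θ' ^ (2 : ℕ) * nBC q Z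
    + ((44 : ℝ) / (9 : ℝ)) * (2 * q - 1) * (2 - 2 * q) ^ (3 : ℕ) * θ * θ' ^ (2 : ℕ) * nBC q Z
    + ((139 : ℝ) / (27 : ℝ)) * (2 * q - 1) ^ (2 : ℕ) * (2 - 2 * q) ^ (2 : ℕ) * θ * θ' ^ (2 : ℕ) * nBC q Z
    + ((1199 : ℝ) / (324 : ℝ)) * (2 * q - 1) ^ (3 : ℕ) * (2 - 2 * q) * θ * θ' ^ (2 : ℕ) * nBC q Z
    + (1 : ℝ) * (2 * q - 1) ^ (4 : ℕ) * θ * θ' ^ (2 : ℕ) * nBC q Z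
    + ((1 : ℝ) / (4 : ℝ)) * (2 - 2 * q) ^ (4 : ℕ) * θ * θ' ^ (2 : ℕ) * (Z.z0 * Z.total - hx Z * hy Z)
    + ((1 : ℝ) / (2 : ℝ)) * (2 * q - 1) * (2 - 2 * q) ^ (3 : ℕ) * θ * θ' ^ (2 : ℕ) * (Z.z0 * Z.total - hx Z * hy Z)
    + ((1 : ℝ) / (27 : ℝ)) * (2 * q - 1) ^ (3 : ℕ) * (2 - 2 * q) * θ ^ (2 : ℕ) * θ' ^ (2 : ℕ) * (Z.z0 * Z.total - hx Z * hy Z)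
    + ((1 : ℝ) / (4 : ℝ)) * (2 - 2 * q) ^ (4 : ℕ) * θ ^ (2 : ℕ) * θ' * (Z.z0 * Z.total - hx Z * hz Z)
    + ((1 : ℝ) / (2 : ℝ)) * (2 * q - 1) * (2 - 2 * q) ^ (3 : ℕ) * θ ^ (2 : ℕ) * θ' * (Z.z0 * Z.total - hx Z * hz Z)
    + ((1 : ℝ) / (27 : ℝ)) * (2 * q - 1) ^ (3 : ℕ) * (2 - 2 * q) * θ ^ (2 : ℕ) * θ' ^ (2 : ℕ) * (Z.z0 * Z.total - hx Z * hz Z)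
    + ((8 : ℝ) / (81 : ℝ)) * (2 * q - 1) ^ (4 : ℕ) * θ * θ' * (Z.z0 * Z.total - hy Z * hz Z)
    + ((4 : ℝ) / (27 : ℝ)) * (2 * q - 1) ^ (3 : ℕ) * (2 - 2 * q) * θ * θ' * lam Z
    + ((1 : ℝ) / (2 : ℝ)) * (2 * q - 1) * (2 - 2 * q) ^ (3 : ℕ) * θ * massA q Z
    + ((29 : ℝ) / (27 : ℝ)) * (2 * q - 1) ^ (2 : ℕ) * (2 - 2 * q) ^ (2 : ℕ) * θ * massA q Z
    + ((875 : ℝ) / (648 : ℝ)) * (2 * q - 1) ^ (3 : ℕ) * (2 - 2 * q) * θ * massA q Z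
    + ((1 : ℝ) / (2 : ℝ)) * (2 * q - 1) ^ (4 : ℕ) * θ * massA q Z
    + ((7 : ℝ) / (8 : ℝ)) * (2 * q - 1) ^ (2 : ℕ) * (2 - 2 * q) ^ (2 : ℕ) * θ * θ' * massA q Z
    + ((3 : ℝ) / (2 : ℝ)) * (2 * q - 1) ^ (3 : ℕ) * (2 - 2 * q) * θ * θ' * massA q Z
    + ((1 : ℝ) / (2 : ℝ)) * (2 * q - 1) ^ (4 : ℕ) * θ * θ' * massA q Z
    + ((1 : ℝ) / (2 : ℝ)) * (2 * q - 1) * (2 - 2 * q) ^ (3 : ℕ) * θ' * massB q Z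
    + ((52 : ℝ) / (27 : ℝ)) * (2 * q - 1) ^ (2 : ℕ) * (2 - 2 * q) ^ (2 : ℕ) * θ' * massB q Z
    + ((875 : ℝ) / (648 : ℝ)) * (2 * q - 1) ^ (3 : ℕ) * (2 - 2 * q) * θ' * massB q Z
    + ((73 : ℝ) / (162 : ℝ)) * (2 * q - 1) ^ (4 : ℕ) * θ' * massB q Z
    + ((281 : ℝ) / (216 : ℝ)) * (2 * q - 1) ^ (2 : ℕ) * (2 - 2 * q) ^ (2 : ℕ) * θ * θ' * massB q Z
    + ((3 : ℝ) / (2 : ℝ)) * (2 * q - 1) ^ (3 : ℕ) * (2 - 2 * q) * θ * θ' * massB q Z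
    + ((1 : ℝ) / (2 : ℝ)) * (2 * q - 1) ^ (4 : ℕ) * θ * θ' * massB q Z
    + ((9 : ℝ) / (8 : ℝ)) * (2 - 2 * q) ^ (4 : ℕ) * θ * θ' * massC q Z
    + ((13 : ℝ) / (2 : ℝ)) * (2 * q - 1) * (2 - 2 * q) ^ (3 : ℕ) * θ * θ' * massC q Z
    + ((2365 : ℝ) / (216 : ℝ)) * (2 * q - 1) ^ (2 : ℕ) * (2 - 2 * q) ^ (2 : ℕ) * θ * θ' * massC q Z
    + ((9785 : ℝ) / (1296 : ℝ)) * (2 * q - 1) ^ (3 : ℕ) * (2 - 2 * q) * θ * θ' * massC q Z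
    + ((583 : ℝ) / (324 : ℝ)) * (2 * q - 1) ^ (4 : ℕ) * θ * θ' * massC q Z
    + ((1 : ℝ) / (2 : ℝ)) * (2 - 2 * q) ^ (4 : ℕ) * θ * θ' ^ (2 : ℕ) * massC q Z
    + ((5 : ℝ) / (2 : ℝ)) * (2 * q - 1) * (2 - 2 * q) ^ (3 : ℕ) * θ * θ' ^ (2 : ℕ) * massC q Z
    + ((9 : ℝ) / (2 : ℝ)) * (2 * q - 1) ^ (2 : ℕ) * (2 - 2 * q) ^ (2 : ℕ) * θ * θ' ^ (2 : ℕ) * massC q Z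

set_option maxHeartbeats 2000000 in
/-- Certificate block 2/4 for `(A)` on `q ∈ [1/2,1]`: non-negative rationals × Bernstein factors in `2q−1` × monomials in `θ, θ'` × valid forms
(found by linear programming, exact rational solve; kit j158090). [folklore] -/
def certHalf2 (q θ θ' : ℝ) (Z : V5) : ℝ :=
    ((7 : ℝ) / (2 : ℝ)) * (2 * q - 1) ^ (3 : ℕ) * (2 - 2 * q) * θ * θ' ^ (2 : ℕ) * massC q Z
    + ((251 : ℝ) / (324 : ℝ)) * (2 * q - 1) ^ (4 : ℕ) * θ * θ' ^ (2 : ℕ) * massC q Z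
    + ((1 : ℝ) / (2 : ℝ)) * (2 - 2 * q) ^ (4 : ℕ) * θ ^ (2 : ℕ) * θ' * massC q Z
    + ((5 : ℝ) / (2 : ℝ)) * (2 * q - 1) * (2 - 2 * q) ^ (3 : ℕ) * θ ^ (2 : ℕ) * θ' * massC q Z
    + ((9 : ℝ) / (2 : ℝ)) * (2 * q - 1) ^ (2 : ℕ) * (2 - 2 * q) ^ (2 : ℕ) * θ ^ (2 : ℕ) * θ' * massC q Z
    + ((7 : ℝ) / (2 : ℝ)) * (2 * q - 1) ^ (3 : ℕ) * (2 - 2 * q) * θ ^ (2 : ℕ) * θ' * massC q Z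
    + ((3 : ℝ) / (4 : ℝ)) * (2 * q - 1) ^ (4 : ℕ) * θ ^ (2 : ℕ) * θ' * massC q Z
    + ((5 : ℝ) / (6 : ℝ)) * (2 - 2 * q) ^ (4 : ℕ) * θ ^ (2 : ℕ) * θ' ^ (2 : ℕ) * massC q Z
    + ((28 : ℝ) / (9 : ℝ)) * (2 * q - 1) * (2 - 2 * q) ^ (3 : ℕ) * θ ^ (2 : ℕ) * θ' ^ (2 : ℕ) * massC q Z
    + ((203 : ℝ) / (54 : ℝ)) * (2 * q - 1) ^ (2 : ℕ) * (2 - 2 * q) ^ (2 : ℕ) * θ ^ (2 : ℕ) * θ' ^ (2 : ℕ) * massC q Z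
    + ((1823 : ℝ) / (1296 : ℝ)) * (2 * q - 1) ^ (3 : ℕ) * (2 - 2 * q) * θ ^ (2 : ℕ) * θ' ^ (2 : ℕ) * massC q Z
    + ((73 : ℝ) / (324 : ℝ)) * (2 * q - 1) ^ (4 : ℕ) * θ ^ (2 : ℕ) * θ' ^ (2 : ℕ) * massC q Z
    + (8 : ℝ) * (2 * q - 1) ^ (3 : ℕ) * (2 - 2 * q) * θ * θ' * (Z.zab * Z.z0)
    + ((3 : ℝ) / (16 : ℝ)) * (2 - 2 * q) ^ (4 : ℕ) * θ * θ' * (Z.zac * Z.z0)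
    + ((51 : ℝ) / (16 : ℝ)) * (2 * q - 1) * (2 - 2 * q) ^ (3 : ℕ) * θ * θ' * (Z.zac * Z.z0)
    + ((3 : ℝ) / (4 : ℝ)) * (2 * q - 1) ^ (2 : ℕ) * (2 - 2 * q) ^ (2 : ℕ) * θ * θ' * (Z.zac * Z.z0)
    + ((19 : ℝ) / (108 : ℝ)) * (2 * q - 1) ^ (3 : ℕ) * (2 - 2 * q) * θ * θ' * (Z.zac * Z.z0)
    + ((4 : ℝ) / (81 : ℝ)) * (2 * q - 1) ^ (4 : ℕ) * θ * θ' * (Z.zac * Z.z0)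
    + ((1 : ℝ) / (2 : ℝ)) * (2 - 2 * q) ^ (4 : ℕ) * θ * θ' ^ (2 : ℕ) * (Z.zac * Z.z0)
    + (3 : ℝ) * (2 * q - 1) * (2 - 2 * q) ^ (3 : ℕ) * θ * θ' ^ (2 : ℕ) * (Z.zac * Z.z0)
    + ((13 : ℝ) / (2 : ℝ)) * (2 * q - 1) ^ (2 : ℕ) * (2 - 2 * q) ^ (2 : ℕ) * θ * θ' ^ (2 : ℕ) * (Z.zac * Z.z0)
    + (6 : ℝ) * (2 * q - 1) ^ (3 : ℕ) * (2 - 2 * q) * θ * θ' ^ (2 : ℕ) * (Z.zac * Z.z0)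
    + (2 : ℝ) * (2 * q - 1) ^ (4 : ℕ) * θ * θ' ^ (2 : ℕ) * (Z.zac * Z.z0)
    + ((1 : ℝ) / (2 : ℝ)) * (2 - 2 * q) ^ (4 : ℕ) * θ ^ (2 : ℕ) * θ' * (Z.zac * Z.z0)
    + (3 : ℝ) * (2 * q - 1) * (2 - 2 * q) ^ (3 : ℕ) * θ ^ (2 : ℕ) * θ' * (Z.zac * Z.z0)
    + ((13 : ℝ) / (2 : ℝ)) * (2 * q - 1) ^ (2 : ℕ) * (2 - 2 * q) ^ (2 : ℕ) * θ ^ (2 : ℕ) * θ' * (Z.zac * Z.z0)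
    + (6 : ℝ) * (2 * q - 1) ^ (3 : ℕ) * (2 - 2 * q) * θ ^ (2 : ℕ) * θ' * (Z.zac * Z.z0)
    + (2 : ℝ) * (2 * q - 1) ^ (4 : ℕ) * θ ^ (2 : ℕ) * θ' * (Z.zac * Z.z0)
    + ((1 : ℝ) / (4 : ℝ)) * (2 - 2 * q) ^ (4 : ℕ) * θ ^ (2 : ℕ) * θ' ^ (2 : ℕ) * (Z.zac * Z.z0)
    + ((3 : ℝ) / (2 : ℝ)) * (2 * q - 1) * (2 - 2 * q) ^ (3 : ℕ) * θ ^ (2 : ℕ) * θ' ^ (2 : ℕ) * (Z.zac * Z.z0)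
    + ((13 : ℝ) / (4 : ℝ)) * (2 * q - 1) ^ (2 : ℕ) * (2 - 2 * q) ^ (2 : ℕ) * θ ^ (2 : ℕ) * θ' ^ (2 : ℕ) * (Z.zac * Z.z0)
    + (3 : ℝ) * (2 * q - 1) ^ (3 : ℕ) * (2 - 2 * q) * θ ^ (2 : ℕ) * θ' ^ (2 : ℕ) * (Z.zac * Z.z0)
    + (1 : ℝ) * (2 * q - 1) ^ (4 : ℕ) * θ ^ (2 : ℕ) * θ' ^ (2 : ℕ) * (Z.zac * Z.z0)
    + ((1 : ℝ) / (2 : ℝ)) * (2 - 2 * q) ^ (4 : ℕ) * θ ^ (2 : ℕ) * θ' * (Z.zac * (Z.total - hx Z))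
    + ((1 : ℝ) / (2 : ℝ)) * (2 * q - 1) * (2 - 2 * q) ^ (3 : ℕ) * θ ^ (2 : ℕ) * θ' * (Z.zac * (Z.total - hx Z))
    + ((7 : ℝ) / (16 : ℝ)) * (2 - 2 * q) ^ (4 : ℕ) * θ * θ' * (Z.zbc * Z.z0)
    + ((11 : ℝ) / (16 : ℝ)) * (2 * q - 1) * (2 - 2 * q) ^ (3 : ℕ) * θ * θ' * (Z.zbc * Z.z0)
    + (8 : ℝ) * (2 * q - 1) ^ (2 : ℕ) * (2 - 2 * q) ^ (2 : ℕ) * θ * θ' * (Z.zbc * Z.z0)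
    + ((19 : ℝ) / (108 : ℝ)) * (2 * q - 1) ^ (3 : ℕ) * (2 - 2 * q) * θ * θ' * (Z.zbc * Z.z0)
    + ((239 : ℝ) / (81 : ℝ)) * (2 * q - 1) ^ (4 : ℕ) * θ * θ' * (Z.zbc * Z.z0)
    + ((1 : ℝ) / (2 : ℝ)) * (2 - 2 * q) ^ (4 : ℕ) * θ * θ' ^ (2 : ℕ) * (Z.zbc * (Z.total - hx Z))
    + ((1 : ℝ) / (2 : ℝ)) * (2 * q - 1) * (2 - 2 * q) ^ (3 : ℕ) * θ * θ' ^ (2 : ℕ) * (Z.zbc * (Z.total - hx Z))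
    + ((5 : ℝ) / (8 : ℝ)) * (2 - 2 * q) ^ (4 : ℕ) * θ * θ' * (Z.z0 * Z.z0)
    + ((31 : ℝ) / (8 : ℝ)) * (2 * q - 1) * (2 - 2 * q) ^ (3 : ℕ) * θ * θ' * (Z.z0 * Z.z0)
    + ((35 : ℝ) / (4 : ℝ)) * (2 * q - 1) ^ (2 : ℕ) * (2 - 2 * q) ^ (2 : ℕ) * θ * θ' * (Z.z0 * Z.z0)
    + ((17 : ℝ) / (2 : ℝ)) * (2 * q - 1) ^ (3 : ℕ) * (2 - 2 * q) * θ * θ' * (Z.z0 * Z.z0)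
    + (3 : ℝ) * (2 * q - 1) ^ (4 : ℕ) * θ * θ' * (Z.z0 * Z.z0)
    + ((1 : ℝ) / (2 : ℝ)) * (2 - 2 * q) ^ (4 : ℕ) * θ * θ' ^ (2 : ℕ) * (Z.z0 * Z.z0)
    + (3 : ℝ) * (2 * q - 1) * (2 - 2 * q) ^ (3 : ℕ) * θ * θ' ^ (2 : ℕ) * (Z.z0 * Z.z0)
    + ((13 : ℝ) / (2 : ℝ)) * (2 * q - 1) ^ (2 : ℕ) * (2 - 2 * q) ^ (2 : ℕ) * θ * θ' ^ (2 : ℕ) * (Z.z0 * Z.z0)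

set_option maxHeartbeats 2000000 in
/-- Certificate block 3/4 for `(A)` on `q ∈ [1/2,1]`: non-negative rationals × Bernstein factors in `2q−1` × monomials in `θ, θ'` × valid forms
(found by linear programming, exact rational solve; kit j158090). [folklore] -/
def certHalf3 (q θ θ' : ℝ) (Z : V5) : ℝ :=
    (6 : ℝ) * (2 * q - 1) ^ (3 : ℕ) * (2 - 2 * q) * θ * θ' ^ (2 : ℕ) * (Z.z0 * Z.z0)
    + (2 : ℝ) * (2 * q - 1) ^ (4 : ℕ) * θ * θ' ^ (2 : ℕ) * (Z.z0 * Z.z0)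
    + ((1 : ℝ) / (2 : ℝ)) * (2 - 2 * q) ^ (4 : ℕ) * θ ^ (2 : ℕ) * θ' * (Z.z0 * Z.z0)
    + (3 : ℝ) * (2 * q - 1) * (2 - 2 * q) ^ (3 : ℕ) * θ ^ (2 : ℕ) * θ' * (Z.z0 * Z.z0)
    + ((13 : ℝ) / (2 : ℝ)) * (2 * q - 1) ^ (2 : ℕ) * (2 - 2 * q) ^ (2 : ℕ) * θ ^ (2 : ℕ) * θ' * (Z.z0 * Z.z0)
    + (6 : ℝ) * (2 * q - 1) ^ (3 : ℕ) * (2 - 2 * q) * θ ^ (2 : ℕ) * θ' * (Z.z0 * Z.z0)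
    + (2 : ℝ) * (2 * q - 1) ^ (4 : ℕ) * θ ^ (2 : ℕ) * θ' * (Z.z0 * Z.z0)
    + ((1 : ℝ) / (4 : ℝ)) * (2 - 2 * q) ^ (4 : ℕ) * θ ^ (2 : ℕ) * θ' ^ (2 : ℕ) * (Z.z0 * Z.z0)
    + ((3 : ℝ) / (2 : ℝ)) * (2 * q - 1) * (2 - 2 * q) ^ (3 : ℕ) * θ ^ (2 : ℕ) * θ' ^ (2 : ℕ) * (Z.z0 * Z.z0)
    + ((13 : ℝ) / (4 : ℝ)) * (2 * q - 1) ^ (2 : ℕ) * (2 - 2 * q) ^ (2 : ℕ) * θ ^ (2 : ℕ) * θ' ^ (2 : ℕ) * (Z.z0 * Z.z0)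
    + (3 : ℝ) * (2 * q - 1) ^ (3 : ℕ) * (2 - 2 * q) * θ ^ (2 : ℕ) * θ' ^ (2 : ℕ) * (Z.z0 * Z.z0)
    + (1 : ℝ) * (2 * q - 1) ^ (4 : ℕ) * θ ^ (2 : ℕ) * θ' ^ (2 : ℕ) * (Z.z0 * Z.z0)
    + ((13 : ℝ) / (16 : ℝ)) * (2 - 2 * q) ^ (4 : ℕ) * θ * θ' * (Z.z0 * (Z.total - hx Z))
    + ((53 : ℝ) / (16 : ℝ)) * (2 * q - 1) * (2 - 2 * q) ^ (3 : ℕ) * θ * θ' * (Z.z0 * (Z.total - hx Z))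
    + ((17 : ℝ) / (4 : ℝ)) * (2 * q - 1) ^ (2 : ℕ) * (2 - 2 * q) ^ (2 : ℕ) * θ * θ' * (Z.z0 * (Z.total - hx Z))
    + ((1061 : ℝ) / (108 : ℝ)) * (2 * q - 1) ^ (3 : ℕ) * (2 - 2 * q) * θ * θ' * (Z.z0 * (Z.total - hx Z))
    + ((4 : ℝ) / (81 : ℝ)) * (2 * q - 1) ^ (4 : ℕ) * θ * θ' * (Z.z0 * (Z.total - hx Z))
    + ((1 : ℝ) / (2 : ℝ)) * (2 - 2 * q) ^ (4 : ℕ) * θ * θ' ^ (2 : ℕ) * (Z.z0 * (Z.total - hx Z))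
    + (2 : ℝ) * (2 * q - 1) * (2 - 2 * q) ^ (3 : ℕ) * θ * θ' ^ (2 : ℕ) * (Z.z0 * (Z.total - hx Z))
    + ((5 : ℝ) / (2 : ℝ)) * (2 * q - 1) ^ (2 : ℕ) * (2 - 2 * q) ^ (2 : ℕ) * θ * θ' ^ (2 : ℕ) * (Z.z0 * (Z.total - hx Z))
    + (1 : ℝ) * (2 * q - 1) ^ (3 : ℕ) * (2 - 2 * q) * θ * θ' ^ (2 : ℕ) * (Z.z0 * (Z.total - hx Z))
    + ((1 : ℝ) / (2 : ℝ)) * (2 - 2 * q) ^ (4 : ℕ) * θ ^ (2 : ℕ) * θ' * (Z.z0 * (Z.total - hx Z))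
    + (2 : ℝ) * (2 * q - 1) * (2 - 2 * q) ^ (3 : ℕ) * θ ^ (2 : ℕ) * θ' * (Z.z0 * (Z.total - hx Z))
    + ((5 : ℝ) / (2 : ℝ)) * (2 * q - 1) ^ (2 : ℕ) * (2 - 2 * q) ^ (2 : ℕ) * θ ^ (2 : ℕ) * θ' * (Z.z0 * (Z.total - hx Z))
    + (1 : ℝ) * (2 * q - 1) ^ (3 : ℕ) * (2 - 2 * q) * θ ^ (2 : ℕ) * θ' * (Z.z0 * (Z.total - hx Z))
    + ((1 : ℝ) / (4 : ℝ)) * (2 - 2 * q) ^ (4 : ℕ) * θ ^ (2 : ℕ) * θ' ^ (2 : ℕ) * (Z.z0 * (Z.total - hx Z))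
    + (1 : ℝ) * (2 * q - 1) * (2 - 2 * q) ^ (3 : ℕ) * θ ^ (2 : ℕ) * θ' ^ (2 : ℕ) * (Z.z0 * (Z.total - hx Z))
    + ((5 : ℝ) / (4 : ℝ)) * (2 * q - 1) ^ (2 : ℕ) * (2 - 2 * q) ^ (2 : ℕ) * θ ^ (2 : ℕ) * θ' ^ (2 : ℕ) * (Z.z0 * (Z.total - hx Z))
    + ((25 : ℝ) / (54 : ℝ)) * (2 * q - 1) ^ (3 : ℕ) * (2 - 2 * q) * θ ^ (2 : ℕ) * θ' ^ (2 : ℕ) * (Z.z0 * (Z.total - hx Z))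
    + ((5 : ℝ) / (2 : ℝ)) * (2 * q - 1) * (2 - 2 * q) ^ (3 : ℕ) * θ * θ' * (Z.z0 * (Z.total - hy Z))
    + ((1 : ℝ) / (2 : ℝ)) * (2 - 2 * q) ^ (4 : ℕ) * θ * θ' ^ (2 : ℕ) * (Z.z0 * (Z.total - hy Z))
    + (3 : ℝ) * (2 * q - 1) * (2 - 2 * q) ^ (3 : ℕ) * θ * θ' ^ (2 : ℕ) * (Z.z0 * (Z.total - hy Z))
    + ((13 : ℝ) / (2 : ℝ)) * (2 * q - 1) ^ (2 : ℕ) * (2 - 2 * q) ^ (2 : ℕ) * θ * θ' ^ (2 : ℕ) * (Z.z0 * (Z.total - hy Z))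
    + (6 : ℝ) * (2 * q - 1) ^ (3 : ℕ) * (2 - 2 * q) * θ * θ' ^ (2 : ℕ) * (Z.z0 * (Z.total - hy Z))
    + (2 : ℝ) * (2 * q - 1) ^ (4 : ℕ) * θ * θ' ^ (2 : ℕ) * (Z.z0 * (Z.total - hy Z))
    + ((1 : ℝ) / (2 : ℝ)) * (2 - 2 * q) ^ (4 : ℕ) * θ ^ (2 : ℕ) * θ' * (Z.z0 * (Z.total - hy Z))
    + (3 : ℝ) * (2 * q - 1) * (2 - 2 * q) ^ (3 : ℕ) * θ ^ (2 : ℕ) * θ' * (Z.z0 * (Z.total - hy Z))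
    + ((13 : ℝ) / (2 : ℝ)) * (2 * q - 1) ^ (2 : ℕ) * (2 - 2 * q) ^ (2 : ℕ) * θ ^ (2 : ℕ) * θ' * (Z.z0 * (Z.total - hy Z))
    + (6 : ℝ) * (2 * q - 1) ^ (3 : ℕ) * (2 - 2 * q) * θ ^ (2 : ℕ) * θ' * (Z.z0 * (Z.total - hy Z))
    + (2 : ℝ) * (2 * q - 1) ^ (4 : ℕ) * θ ^ (2 : ℕ) * θ' * (Z.z0 * (Z.total - hy Z))
    + ((1 : ℝ) / (4 : ℝ)) * (2 - 2 * q) ^ (4 : ℕ) * θ ^ (2 : ℕ) * θ' ^ (2 : ℕ) * (Z.z0 * (Z.total - hy Z))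
    + ((3 : ℝ) / (2 : ℝ)) * (2 * q - 1) * (2 - 2 * q) ^ (3 : ℕ) * θ ^ (2 : ℕ) * θ' ^ (2 : ℕ) * (Z.z0 * (Z.total - hy Z))
    + ((13 : ℝ) / (4 : ℝ)) * (2 * q - 1) ^ (2 : ℕ) * (2 - 2 * q) ^ (2 : ℕ) * θ ^ (2 : ℕ) * θ' ^ (2 : ℕ) * (Z.z0 * (Z.total - hy Z))
    + (3 : ℝ) * (2 * q - 1) ^ (3 : ℕ) * (2 - 2 * q) * θ ^ (2 : ℕ) * θ' ^ (2 : ℕ) * (Z.z0 * (Z.total - hy Z))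
    + (1 : ℝ) * (2 * q - 1) ^ (4 : ℕ) * θ ^ (2 : ℕ) * θ' ^ (2 : ℕ) * (Z.z0 * (Z.total - hy Z))
    + ((1 : ℝ) / (4 : ℝ)) * (2 - 2 * q) ^ (4 : ℕ) * θ * θ' * (Z.z0 * (Z.total - hz Z))
    + ((29 : ℝ) / (4 : ℝ)) * (2 * q - 1) ^ (2 : ℕ) * (2 - 2 * q) ^ (2 : ℕ) * θ * θ' * (Z.z0 * (Z.total - hz Z))
    + ((235 : ℝ) / (81 : ℝ)) * (2 * q - 1) ^ (4 : ℕ) * θ * θ' * (Z.z0 * (Z.total - hz Z))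
    + ((1 : ℝ) / (8 : ℝ)) * (2 - 2 * q) ^ (4 : ℕ) * θ * θ' * uForm q 1 1 Z
    + ((23 : ℝ) / (54 : ℝ)) * (2 * q - 1) ^ (2 : ℕ) * (2 - 2 * q) ^ (2 : ℕ) * θ * θ' * uForm q 1 1 Z

set_option maxHeartbeats 2000000 in
/-- Certificate block 4/4 for `(A)` on `q ∈ [1/2,1]`: non-negative rationals × Bernstein factors in `2q−1` × monomials in `θ, θ'` × valid forms
(found by linear programming, exact rational solve; kit j158090). [folklore] -/
def certHalf4 (q θ θ' : ℝ) (Z : V5) : ℝ :=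
    ((1 : ℝ) / (8 : ℝ)) * (2 - 2 * q) ^ (4 : ℕ) * θ * θ' * phiB q 1 1 Z
    + ((1231 : ℝ) / (1296 : ℝ)) * (2 * q - 1) ^ (3 : ℕ) * (2 - 2 * q) * θ * θ' * phiC q 1 1 Z
    + ((227 : ℝ) / (324 : ℝ)) * (2 * q - 1) ^ (4 : ℕ) * θ * θ' * phiC q 1 1 Z
    + ((73 : ℝ) / (324 : ℝ)) * (2 * q - 1) ^ (4 : ℕ) * θ * θ' ^ (2 : ℕ) * phiC q 1 1 Z
    + ((1 : ℝ) / (4 : ℝ)) * (2 * q - 1) ^ (4 : ℕ) * θ ^ (2 : ℕ) * θ' * phiC q 1 1 Z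
    + ((1 : ℝ) / (6 : ℝ)) * (2 - 2 * q) ^ (4 : ℕ) * θ ^ (2 : ℕ) * θ' ^ (2 : ℕ) * phiC q 1 1 Z
    + ((8 : ℝ) / (9 : ℝ)) * (2 * q - 1) * (2 - 2 * q) ^ (3 : ℕ) * θ ^ (2 : ℕ) * θ' ^ (2 : ℕ) * phiC q 1 1 Z
    + ((67 : ℝ) / (54 : ℝ)) * (2 * q - 1) ^ (2 : ℕ) * (2 - 2 * q) ^ (2 : ℕ) * θ ^ (2 : ℕ) * θ' ^ (2 : ℕ) * phiC q 1 1 Z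
    + ((575 : ℝ) / (1296 : ℝ)) * (2 * q - 1) ^ (3 : ℕ) * (2 - 2 * q) * θ ^ (2 : ℕ) * θ' ^ (2 : ℕ) * phiC q 1 1 Z
    + ((73 : ℝ) / (324 : ℝ)) * (2 * q - 1) ^ (4 : ℕ) * θ ^ (2 : ℕ) * θ' ^ (2 : ℕ) * phiC q 1 1 Z
    + ((1 : ℝ) / (2 : ℝ)) * (2 - 2 * q) ^ (4 : ℕ) * uForm q 1 θ Z
    + (2 : ℝ) * (2 * q - 1) * (2 - 2 * q) ^ (3 : ℕ) * uForm q 1 θ Z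
    + ((139 : ℝ) / (54 : ℝ)) * (2 * q - 1) ^ (2 : ℕ) * (2 - 2 * q) ^ (2 : ℕ) * uForm q 1 θ Z
    + ((1199 : ℝ) / (648 : ℝ)) * (2 * q - 1) ^ (3 : ℕ) * (2 - 2 * q) * uForm q 1 θ Z
    + ((1 : ℝ) / (2 : ℝ)) * (2 * q - 1) ^ (4 : ℕ) * uForm q 1 θ Z
    + ((1 : ℝ) / (2 : ℝ)) * (2 - 2 * q) ^ (4 : ℕ) * θ' * uForm q 1 θ Z
    + (2 : ℝ) * (2 * q - 1) * (2 - 2 * q) ^ (3 : ℕ) * θ' * uForm q 1 θ Z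
    + ((139 : ℝ) / (54 : ℝ)) * (2 * q - 1) ^ (2 : ℕ) * (2 - 2 * q) ^ (2 : ℕ) * θ' * uForm q 1 θ Z
    + ((1393 : ℝ) / (648 : ℝ)) * (2 * q - 1) ^ (3 : ℕ) * (2 - 2 * q) * θ' * uForm q 1 θ Z
    + ((89 : ℝ) / (162 : ℝ)) * (2 * q - 1) ^ (4 : ℕ) * θ' * uForm q 1 θ Z
    + ((1 : ℝ) / (2 : ℝ)) * (2 - 2 * q) ^ (4 : ℕ) * phiB q 1 θ' Z
    + (2 : ℝ) * (2 * q - 1) * (2 - 2 * q) ^ (3 : ℕ) * phiB q 1 θ' Z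
    + ((185 : ℝ) / (54 : ℝ)) * (2 * q - 1) ^ (2 : ℕ) * (2 - 2 * q) ^ (2 : ℕ) * phiB q 1 θ' Z
    + ((1199 : ℝ) / (648 : ℝ)) * (2 * q - 1) ^ (3 : ℕ) * (2 - 2 * q) * phiB q 1 θ' Z
    + ((73 : ℝ) / (162 : ℝ)) * (2 * q - 1) ^ (4 : ℕ) * phiB q 1 θ' Z
    + ((1 : ℝ) / (2 : ℝ)) * (2 - 2 * q) ^ (4 : ℕ) * θ * phiB q 1 θ' Z
    + (2 : ℝ) * (2 * q - 1) * (2 - 2 * q) ^ (3 : ℕ) * θ * phiB q 1 θ' Z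
    + ((185 : ℝ) / (54 : ℝ)) * (2 * q - 1) ^ (2 : ℕ) * (2 - 2 * q) ^ (2 : ℕ) * θ * phiB q 1 θ' Z
    + ((1393 : ℝ) / (648 : ℝ)) * (2 * q - 1) ^ (3 : ℕ) * (2 - 2 * q) * θ * phiB q 1 θ' Z
    + ((1 : ℝ) / (2 : ℝ)) * (2 * q - 1) ^ (4 : ℕ) * θ * phiB q 1 θ' Z
    + ((1 : ℝ) / (12 : ℝ)) * (2 - 2 * q) ^ (4 : ℕ) * θ * phiC q 1 θ' Z
    + ((11 : ℝ) / (18 : ℝ)) * (2 * q - 1) * (2 - 2 * q) ^ (3 : ℕ) * θ * phiC q 1 θ' Z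
    + ((185 : ℝ) / (54 : ℝ)) * (2 * q - 1) ^ (2 : ℕ) * (2 - 2 * q) ^ (2 : ℕ) * θ * phiC q 1 θ' Z
    + ((1393 : ℝ) / (648 : ℝ)) * (2 * q - 1) ^ (3 : ℕ) * (2 - 2 * q) * θ * phiC q 1 θ' Z
    + ((1 : ℝ) / (2 : ℝ)) * (2 * q - 1) ^ (4 : ℕ) * θ * phiC q 1 θ' Z
    + (1 : ℝ) * (2 * q - 1) ^ (2 : ℕ) * (2 - 2 * q) ^ (2 : ℕ) * θ ^ (2 : ℕ) * phiC q 1 θ' Z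
    + (2 : ℝ) * (2 * q - 1) ^ (3 : ℕ) * (2 - 2 * q) * θ ^ (2 : ℕ) * phiC q 1 θ' Z
    + ((1 : ℝ) / (2 : ℝ)) * (2 * q - 1) ^ (4 : ℕ) * θ ^ (2 : ℕ) * phiC q 1 θ' Z
    + ((97 : ℝ) / (648 : ℝ)) * (2 * q - 1) ^ (3 : ℕ) * (2 - 2 * q) * uForm q 1 (θ * θ') Z
    + ((97 : ℝ) / (648 : ℝ)) * (2 * q - 1) ^ (3 : ℕ) * (2 - 2 * q) * phiB q 1 (θ * θ') Z
    + ((4 : ℝ) / (81 : ℝ)) * (2 * q - 1) ^ (4 : ℕ) * phiB q 1 (θ * θ') Z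
    + ((139 : ℝ) / (54 : ℝ)) * (2 * q - 1) ^ (2 : ℕ) * (2 - 2 * q) ^ (2 : ℕ) * θ' * phiC q θ 1 Z
    + ((1393 : ℝ) / (648 : ℝ)) * (2 * q - 1) ^ (3 : ℕ) * (2 - 2 * q) * θ' * phiC q θ 1 Z
    + ((89 : ℝ) / (162 : ℝ)) * (2 * q - 1) ^ (4 : ℕ) * θ' * phiC q θ 1 Z
    + (1 : ℝ) * (2 * q - 1) ^ (2 : ℕ) * (2 - 2 * q) ^ (2 : ℕ) * θ' ^ (2 : ℕ) * phiC q θ 1 Z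
    + (2 : ℝ) * (2 * q - 1) ^ (3 : ℕ) * (2 - 2 * q) * θ' ^ (2 : ℕ) * phiC q θ 1 Z
    + ((89 : ℝ) / (162 : ℝ)) * (2 * q - 1) ^ (4 : ℕ) * θ' ^ (2 : ℕ) * phiC q θ 1 Z
    + (2 : ℝ) * (2 * q - 1) * (2 - 2 * q) ^ (3 : ℕ) * phiC q θ θ' Z
    + ((97 : ℝ) / (648 : ℝ)) * (2 * q - 1) ^ (3 : ℕ) * (2 - 2 * q) * phiC q θ θ' Z

set_option maxHeartbeats 8000000 in
/-- **Certificate identity**: on expanding, the four certificate blocks sum to the frontier form `vForm`. [folklore] -/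
theorem vForm_eq_certHalf (q θ θ' : ℝ) (Z : V5) :
    vForm q θ θ' Z = certHalf1 q θ θ' Z + certHalf2 q θ θ' Z + certHalf3 q θ θ' Z + certHalf4 q θ θ' Z := by
  simp only [vForm, envForm, certHalf1, certHalf2, certHalf3, certHalf4, phiC, uForm, phiB, nAB, nAC, nBC, eAA, eBB, eCC, pAB, pAC, pBC, pTop, massA, massB, massC, lam, masterN, swapAB, swapBC, hx, hy, hz, V5.total]
  ring

/-- The letter S-quantities in hat form: `κ(swapAB z) = û v̂ − x̂ ŷ`, `κ(z) = û v̂ − x̂ ẑ`, `κ(swapBC z) = û v̂ − ŷ ẑ`. [folklore] -/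
theorem kap_hat (z : V5) :
    kap (swapAB z) = z.z0 * z.total - hx z * hy z ∧ kap z = z.z0 * z.total - hx z * hz z ∧ kap (swapBC z) = z.z0 * z.total - hy z * hz z := by
  refine ⟨?_, ?_, ?_⟩ <;> simp only [kap, swapAB, swapBC, hx, hy, hz, V5.total] <;> ring

/-- The kap-type (S) inequalities `û v̂ ≥ x̂ŷ, x̂ẑ, ŷẑ` on the monoid (letters: `IsLetter.kap_nonneg`; products: hats multiply). [folklore] -/
theorem InK.s_nonneg {q : ℝ} (hq0 : 0 ≤ q) {Z : V5} (h : InK q Z) :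
    0 ≤ Z.z0 * Z.total - hx Z * hy Z ∧ 0 ≤ Z.z0 * Z.total - hx Z * hz Z ∧ 0 ≤ Z.z0 * Z.total - hy Z * hz Z := by
  induction h with
  | base => simp [delta0, hx, hy, hz, V5.total]
  | @step z Z hz' hZ ih =>
    obtain ⟨i1, i2, i3⟩ := ih
    obtain ⟨ka, kb, kc⟩ := kap_hat z
    have k1 : 0 ≤ z.z0 * z.total - hx z * hy z := by rw [← ka]; exact (hz'.swapAB).kap_nonneg hq0
    have k2 : 0 ≤ z.z0 * z.total - hx z * hz z := by rw [← kb]; exact hz'.kap_nonneg hq0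
    have k3 : 0 ≤ z.z0 * z.total - hy z * hz z := by rw [← kc]; exact (hz'.swapBC).kap_nonneg hq0
    obtain ⟨a0, aab, aac, abc, a1⟩ := hz'.nonneg hq0
    obtain ⟨b0, bab, bac, bbc, b1⟩ := hZ.nonneg hq0
    obtain ⟨e0, ex, ey, ez, ev⟩ := hat_conv z Z
    rw [e0, ex, ey, ez, ev]
    have hxz0 : 0 ≤ hx z := by simp only [hx]; positivity
    have hyz0 : 0 ≤ hy z := by simp only [hy]; positivity
    have hzz0 : 0 ≤ hz z := by simp only [hz]; positivity
    have hxZ0 : 0 ≤ hx Z := by simp only [hx]; positivity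
    have hyZ0 : 0 ≤ hy Z := by simp only [hy]; positivity
    have hzZ0 : 0 ≤ hz Z := by simp only [hz]; positivity
    refine ⟨?_, ?_, ?_⟩
    · have e : z.z0 * Z.z0 * (z.total * Z.total) - hx z * hx Z * (hy z * hy Z) =
          (z.z0 * z.total) * (Z.z0 * Z.total) - (hx z * hy z) * (hx Z * hy Z) := by ring
      rw [e]
      have m := mul_le_mul (show hx z * hy z ≤ z.z0 * z.total by linarith) (show hx Z * hy Z ≤ Z.z0 * Z.total by linarith)
        (by positivity : 0 ≤ hx Z * hy Z) (by nlinarith : 0 ≤ z.z0 * z.total)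
      linarith
    · have e : z.z0 * Z.z0 * (z.total * Z.total) - hx z * hx Z * (hz z * hz Z) =
          (z.z0 * z.total) * (Z.z0 * Z.total) - (hx z * hz z) * (hx Z * hz Z) := by ring
      rw [e]
      have m := mul_le_mul (show hx z * hz z ≤ z.z0 * z.total by linarith) (show hx Z * hz Z ≤ Z.z0 * Z.total by linarith)
        (by positivity : 0 ≤ hx Z * hz Z) (by nlinarith : 0 ≤ z.z0 * z.total)
      linarith
    · have e : z.z0 * Z.z0 * (z.total * Z.total) - hy z * hy Z * (hz z * hz Z) =
          (z.z0 * z.total) * (Z.z0 * Z.total) - (hy z * hz z) * (hy Z * hz Z) := by ring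
      rw [e]
      have m := mul_le_mul (show hy z * hz z ≤ z.z0 * z.total by linarith) (show hy Z * hz Z ≤ Z.z0 * Z.total by linarith)
        (by positivity : 0 ≤ hy Z * hz Z) (by nlinarith : 0 ≤ z.z0 * z.total)
      linarith

set_option maxHeartbeats 8000000 in
/-- **(A) holds for `q ∈ [1/2, 1]`**: every term of the certificate is a product of non-negative factors on the monoid. [folklore] -/
theorem envelopeA_of_half_le {q : ℝ} (hq : 1 / 2 ≤ q) (hq1 : q ≤ 1) : EnvelopeA q := by
  intro θ θ' hθ hθ' Z hZ
  have hq0 : 0 < q := by linarith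
  rw [vForm_eq_certHalf]
  obtain ⟨h0, hab, hac, hbc, h1⟩ := hZ.nonneg hq0.le
  obtain ⟨s1, s2, s3⟩ := hZ.s_nonneg hq0.le
  have hB1 : 0 ≤ 2 * q - 1 := by linarith
  have hB2 : 0 ≤ 2 - 2 * q := by linarith
  have hvx : 0 ≤ Z.total - hx Z := by simp only [hx, V5.total]; linarith
  have hvy : 0 ≤ Z.total - hy Z := by simp only [hy, V5.total]; linarith
  have hvz : 0 ≤ Z.total - hz Z := by simp only [hz, V5.total]; linarith
  have hMc : massC q Z = (Z.zac + Z.zbc + q * Z.z0) * (Z.zac + Z.zbc + Z.z1) := by simp only [massC, hx, hy, hz, V5.total]; ring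
  have g0 : 0 ≤ lam Z := hZ.lam_nonneg hq0.le
  have g1 : 0 ≤ massA q Z := by unfold massA; positivity
  have g2 : 0 ≤ massB q Z := by unfold massB; positivity
  have g3 : 0 ≤ massC q Z := by rw [hMc]; positivity
  have g4 : 0 ≤ nAB q Z := by rw [nAB_eq]; exact hZ.swapBC.masterN_nonneg hq0.le hq1
  have g5 : 0 ≤ nAC q Z := by rw [nAC_eq]; exact hZ.masterN_nonneg hq0.le hq1
  have g6 : 0 ≤ nBC q Z := by rw [nBC_eq]; exact hZ.swapAB.masterN_nonneg hq0.le hq1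
  have g7 : 0 ≤ uForm q 1 1 Z := hZ.uCond hq0 hq1 1 1 zero_le_one zero_le_one
  have g8 : 0 ≤ uForm q 1 θ Z := hZ.uCond hq0 hq1 1 θ zero_le_one hθ
  have g9 : 0 ≤ uForm q 1 (θ * θ') Z := hZ.uCond hq0 hq1 1 (θ * θ') zero_le_one (mul_nonneg hθ hθ')
  have g10 : 0 ≤ phiB q 1 1 Z := hZ.phiB_nonneg hq0 hq1 zero_le_one zero_le_one
  have g11 : 0 ≤ phiB q 1 (θ * θ') Z := hZ.phiB_nonneg hq0 hq1 zero_le_one (mul_nonneg hθ hθ')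
  have g12 : 0 ≤ phiB q 1 θ' Z := hZ.phiB_nonneg hq0 hq1 zero_le_one hθ'
  have g13 : 0 ≤ phiC q 1 1 Z := by rw [phiC_eq_uForm]; exact hZ.swapAB.swapBC.swapAB.uCond hq0 hq1 1 1 zero_le_one zero_le_one
  have g14 : 0 ≤ phiC q 1 θ' Z := by rw [phiC_eq_uForm]; exact hZ.swapAB.swapBC.swapAB.uCond hq0 hq1 θ' 1 hθ' zero_le_one
  have g15 : 0 ≤ phiC q θ 1 Z := by rw [phiC_eq_uForm]; exact hZ.swapAB.swapBC.swapAB.uCond hq0 hq1 1 θ zero_le_one hθ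
  have g16 : 0 ≤ phiC q θ θ' Z := by rw [phiC_eq_uForm]; exact hZ.swapAB.swapBC.swapAB.uCond hq0 hq1 θ' θ hθ' hθ
  have g20 : 0 ≤ (Z.z0 * Z.z0) := mul_nonneg h0 h0
  have g21 : 0 ≤ (Z.z0 * (Z.total - hx Z)) := mul_nonneg h0 hvx
  have g22 : 0 ≤ (Z.z0 * (Z.total - hy Z)) := mul_nonneg h0 hvy
  have g23 : 0 ≤ (Z.z0 * (Z.total - hz Z)) := mul_nonneg h0 hvz
  have g24 : 0 ≤ (Z.zab * Z.z0) := mul_nonneg hab h0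
  have g25 : 0 ≤ (Z.zac * Z.z0) := mul_nonneg hac h0
  have g26 : 0 ≤ (Z.zac * (Z.total - hx Z)) := mul_nonneg hac hvx
  have g27 : 0 ≤ (Z.zbc * Z.z0) := mul_nonneg hbc h0
  have g28 : 0 ≤ (Z.zbc * (Z.total - hx Z)) := mul_nonneg hbc hvx
  unfold certHalf1 certHalf2 certHalf3 certHalf4
  positivity

/-- **Type T3 for `q ∈ [1/2, 1]`**: the Rayleigh difference `Z¹⁰Z⁰¹ − Z¹¹Z⁰⁰` of two leaf edges at different apices and different leaves of the
weighted `K_{1,1,1,n}` is non-negative for all leaf probabilities and every rest `R` in the three-apex monoid. [folklore] -/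
theorem InK.t3Form_nonneg_of_half_le {q : ℝ} (hq : 1 / 2 ≤ q) (hq1 : q ≤ 1) {b₁ c₁ a₂ c₂ : ℝ}
    (hb0 : 0 ≤ b₁) (hb1 : b₁ ≤ 1) (hc0 : 0 ≤ c₁) (hc1 : c₁ ≤ 1) (ha0 : 0 ≤ a₂) (ha1 : a₂ ≤ 1) (hd0 : 0 ≤ c₂) (hd1 : c₂ ≤ 1)
    {R : V5} (hR : InK q R) : 0 ≤ t3Form q b₁ c₁ a₂ c₂ R :=
  hR.t3Form_nonneg_of_envelopeA (by linarith) hq1 (envelopeA_of_half_le hq hq1) hb0 hb1 hc0 hc1 ha0 ha1 hd0 hd1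

end ThreeApex

end FK

end Summit.CriticalPhenomena.PercolationContinuityZ3.Theorems
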